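import Summits.CriticalPhenomena.PercolationContinuityZ3.Theses.PercFoamCut
import Summits.CriticalPhenomena.PercolationContinuityZ3.Theorems.PercFoamCutKGivesMacroCutLog
import Summits.CriticalPhenomena.PercolationContinuityZ3.Theorems.PercPorousCriticalFiniteClusterVolumeTail
import HarnessLib

/-!
# `PercFoamCut.MacroCutLog` (stmt-CriticalPhenomena-5333) — settled by composition

builds on p205010 (kernel theorem, internal audit signed; external expert review pending) — USED, through
`PercPorousCriticalFiniteClusterVolumeTail.finiteClusterVolumeTail_proof` (the Kesten–Zhang surface-order
law `P_p(m ≤ |C(0)| < ∞) ≤ exp(-c m^{2/3})` at every percolating `p`, which the tree derives from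
`θ(p_c(ℤ³)) = 0`: a percolating `p` is supercritical).

RSW3 lane (cell `prim-rsw3`, prover P2, gen 34).  The crux `MacroCutLog` of route `PercFoamCut` (ANTI-FOAM:
for every `p` with `θ(p) > 0` and every `a > 0` there is `c > 0` such that the probability that the trace
of the infinite cluster on `Λ_n` splits into two parts of `≥ a|Λ_n|` vertices each with at most
`c n² / log n` open edges leaving the first part tends to `0`) is the modus ponens of two theorems already
in the tree:

* `MacroCutLog.kGivesMacroCutLog_proof` (stmt-5337, `T/PercFoamCutKGivesMacroCutLog.lean`): the p-blind
  implication `FiniteClusterVolumeTail → MacroCutLog` (arXiv:2207.05226 Remark 1.2: gate counting + union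
  bound), whose hypothesis is VERBATIM the statement `PercPorousCritical.FiniteClusterVolumeTail`;
* `PercPorousCriticalFiniteClusterVolumeTail.finiteClusterVolumeTail_proof` (`T/PercPorousCriticalFiniteClusterVolumeTail.lean`):
  that hypothesis, proved.

No new mathematics is claimed here; the file records the closure of the item in the kernel.
-/

namespace Summit.CriticalPhenomena.PercolationContinuityZ3.Theorems.FoamCutMacroCutLog

/-- **`PercFoamCut.MacroCutLog` (stmt-CriticalPhenomena-5333).**  For every `p` with `θ_{ℤ³}(p) > 0` and
every `a > 0` there is `c > 0` with
`P_p(∃ A ⊆ Λ_n ∩ C_∞ : |A| ≥ a(2n+1)³, |(Λ_n ∩ C_∞) ∖ A| ≥ a(2n+1)³, #{open edges of ∂_E A} ≤ c n²/log n) → 0`.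
Proof: `KGivesMacroCutLog` (stmt-5337, proved) applied to `FiniteClusterVolumeTail` (proved via p205010). -/
theorem macroCutLog_proof :
    Summit.CriticalPhenomena.PercolationContinuityZ3.Theses.PercFoamCut.MacroCutLog := by
  have h := MacroCutLog.kGivesMacroCutLog_proof
  unfold Summit.CriticalPhenomena.PercolationContinuityZ3.Theses.PercFoamCut.KGivesMacroCutLog at h
  have k := PercPorousCriticalFiniteClusterVolumeTail.finiteClusterVolumeTail_proof
  unfold Summit.CriticalPhenomena.PercolationContinuityZ3.Theses.PercPorousCritical.FiniteClusterVolumeTail at k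
  exact h k

end Summit.CriticalPhenomena.PercolationContinuityZ3.Theorems.FoamCutMacroCutLog
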